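import Mathlib.RingTheory.Artinian.Module
import Mathlib.LinearAlgebra.Projection
import HarnessLib

/-!
# Hida's ordinary projector on a module of finite length: the Fitting decomposition of `U_p`

For an endomorphism `U` of a Noetherian and Artinian module `M` (e.g. a finite `ℤ_p`-module such
as the finite approximation modules `Symb_Γ(𝔻⁰/K_N)` of `PAdicMeasureLattice`), Fitting's lemma
(Mathlib `LinearMap.isCompl_iSup_ker_pow_iInf_range_pow`) decomposes

  `M = M^{nil} ⊕ M^{ord}`,  `M^{nil} = ⋃ₙ ker Uⁿ`,  `M^{ord} = ⋂ₙ range Uⁿ`.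

**Hida's ordinary projector** `e = ordProj U` is the projection onto `M^{ord}` along `M^{nil}` — the
value of `lim U^{n!}` (Hida; Eigenbook §2.? / Hida, *Elementary theory of L-functions and Eisenstein
series*, §7.2, Lemma 1).  This file proves what the `Λ`-adic theory uses of it: `e` is an idempotent
(`ordProj_idem`) with image `M^{ord}` and kernel `M^{nil}` (`ordProj_apply_of_mem_ordPart`,
`ordProj_apply_of_mem_nilPart`, `range_ordProj`, `ker_ordProj`), it commutes with every endomorphism
commuting with `U` (`ordProj_comm`), in particular with `U`, and it is natural for `U`-equivariant maps
between modules (`map_ordProj`: a linear `S` with `S ∘ U = U' ∘ S` satisfies `S ∘ e = e' ∘ S`) — the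
compatibility making ordinary parts functorial along specialisation maps.

Brick B2h of the bottom-up plan recorded with the named fact
`greenbergStevens_kitagawa_twoVariable_interpolation_allBranches`.  Everything is proved; no named facts.

## References

* H. Hida, *Elementary theory of `L`-functions and Eisenstein series*, LMS Student Texts 26 (1993),
  §7.2. [Hida1993LFE]
* J. Bellaïche, *The Eigenbook* (2021), §6.5. [folklore]
-/

namespace Literature.NumberTheory.EllipticCurves

namespace HidaProjector

open LinearMap

variable {R M M' : Type*} [CommRing R] [AddCommGroup M] [Module R M] [AddCommGroup M'] [Module R M']

/-- **The ordinary part `M^{ord} = ⋂ₙ range Uⁿ`.** [cite: Hida1993LFE, §7.2] -/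
def ordPart (U : Module.End R M) : Submodule R M := ⨅ n : ℕ, LinearMap.range (U ^ n)

/-- **The nilpotent part `M^{nil} = ⋃ₙ ker Uⁿ`.** [cite: Hida1993LFE, §7.2] -/
def nilPart (U : Module.End R M) : Submodule R M := ⨆ n : ℕ, LinearMap.ker (U ^ n)

/-- Membership in the ordinary part. [folklore] -/
theorem mem_ordPart_iff {U : Module.End R M} {x : M} : x ∈ ordPart U ↔ ∀ n : ℕ, x ∈ LinearMap.range (U ^ n) := by
  rw [ordPart, Submodule.mem_iInf]

/-- `ker Uⁿ ⊆ M^{nil}`. [folklore] -/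
theorem ker_pow_le_nilPart (U : Module.End R M) (n : ℕ) : LinearMap.ker (U ^ n) ≤ nilPart U :=
  le_iSup (fun n => LinearMap.ker (U ^ n)) n

/-- A map intertwining `U` and `U'` intertwines their powers. [folklore] -/
theorem pow_comp_eq_comp_pow {U : Module.End R M} {U' : Module.End R M'} {S : M →ₗ[R] M'}
    (hS : S.comp U = U'.comp S) : ∀ n : ℕ, (U' ^ n).comp S = S.comp (U ^ n)
  | 0 => rfl
  | k + 1 => by
    rw [pow_succ, pow_succ, Module.End.mul_eq_comp, Module.End.mul_eq_comp, LinearMap.comp_assoc, ← hS,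
      ← LinearMap.comp_assoc, pow_comp_eq_comp_pow hS k, LinearMap.comp_assoc]

/-- An endomorphism commuting with `U` preserves `M^{ord}`. [folklore] -/
theorem ordPart_le_comap {U g : Module.End R M} (hg : g.comp U = U.comp g) : ordPart U ≤ (ordPart U).comap g := by
  intro x hx
  rw [Submodule.mem_comap, mem_ordPart_iff]
  intro n
  obtain ⟨y, rfl⟩ := mem_ordPart_iff.mp hx n
  exact ⟨g y, LinearMap.congr_fun (pow_comp_eq_comp_pow hg n) y⟩

/-- An endomorphism commuting with `U` preserves `M^{nil}`. [folklore] -/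
theorem nilPart_le_comap {U g : Module.End R M} (hg : g.comp U = U.comp g) : nilPart U ≤ (nilPart U).comap g := by
  refine iSup_le fun n => ?_
  intro x hx
  rw [Submodule.mem_comap]
  refine ker_pow_le_nilPart U n ?_
  rw [LinearMap.mem_ker] at hx ⊢
  have := LinearMap.congr_fun (pow_comp_eq_comp_pow hg n) x
  rw [LinearMap.comp_apply, LinearMap.comp_apply] at this
  rw [this, hx, map_zero]

variable [IsNoetherian R M] [IsArtinian R M]

/-- **Fitting's lemma**: `M = M^{nil} ⊕ M^{ord}`. [folklore] -/
theorem isCompl_nilPart_ordPart (U : Module.End R M) : IsCompl (nilPart U) (ordPart U) :=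
  U.isCompl_iSup_ker_pow_iInf_range_pow

/-- **Hida's ordinary projector** `e`: the projection onto `M^{ord}` along `M^{nil}`.
[cite: Hida1993LFE, §7.2] -/
noncomputable def ordProj (U : Module.End R M) : Module.End R M :=
  LinearMap.ofIsCompl (isCompl_nilPart_ordPart U) (0 : nilPart U →ₗ[R] M) (ordPart U).subtype

/-- `e x = x` on the ordinary part. [folklore] -/
theorem ordProj_apply_of_mem_ordPart (U : Module.End R M) {x : M} (hx : x ∈ ordPart U) : ordProj U x = x := by
  have h := LinearMap.ofIsCompl_apply_right (isCompl_nilPart_ordPart U) (φ := (0 : nilPart U →ₗ[R] M))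
    (ψ := (ordPart U).subtype) ⟨x, hx⟩
  exact h

/-- `e x = 0` on the nilpotent part. [folklore] -/
theorem ordProj_apply_of_mem_nilPart (U : Module.End R M) {x : M} (hx : x ∈ nilPart U) : ordProj U x = 0 := by
  have h := LinearMap.ofIsCompl_apply_left (isCompl_nilPart_ordPart U) (φ := (0 : nilPart U →ₗ[R] M))
    (ψ := (ordPart U).subtype) ⟨x, hx⟩
  exact h

/-- Every `x` is `n + o` with `n ∈ M^{nil}`, `o ∈ M^{ord}`. [folklore] -/
theorem exists_nil_add_ord (U : Module.End R M) (x : M) :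
    ∃ n ∈ nilPart U, ∃ o ∈ ordPart U, x = n + o := by
  obtain ⟨n, o, h, -⟩ := Submodule.existsUnique_add_of_isCompl (isCompl_nilPart_ordPart U) x
  exact ⟨n, n.2, o, o.2, h.symm⟩

/-- `e x ∈ M^{ord}`. [folklore] -/
theorem ordProj_mem_ordPart (U : Module.End R M) (x : M) : ordProj U x ∈ ordPart U := by
  obtain ⟨n, hn, o, ho, rfl⟩ := exists_nil_add_ord U x
  rw [map_add, ordProj_apply_of_mem_nilPart U hn, ordProj_apply_of_mem_ordPart U ho, zero_add]
  exact ho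

/-- `x − e x ∈ M^{nil}`. [folklore] -/
theorem sub_ordProj_mem_nilPart (U : Module.End R M) (x : M) : x - ordProj U x ∈ nilPart U := by
  obtain ⟨n, hn, o, ho, rfl⟩ := exists_nil_add_ord U x
  rw [map_add, ordProj_apply_of_mem_nilPart U hn, ordProj_apply_of_mem_ordPart U ho, zero_add, add_sub_cancel_right]
  exact hn

/-- **`e` is an idempotent.** [folklore] -/
theorem ordProj_idem (U : Module.End R M) : (ordProj U).comp (ordProj U) = ordProj U :=
  LinearMap.ext fun x => ordProj_apply_of_mem_ordPart U (ordProj_mem_ordPart U x)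

/-- The range of `e` is `M^{ord}`. [folklore] -/
theorem range_ordProj (U : Module.End R M) : LinearMap.range (ordProj U) = ordPart U := by
  refine le_antisymm ?_ fun x hx => ⟨x, ordProj_apply_of_mem_ordPart U hx⟩
  rintro _ ⟨x, rfl⟩
  exact ordProj_mem_ordPart U x

/-- The kernel of `e` is `M^{nil}`. [folklore] -/
theorem ker_ordProj (U : Module.End R M) : LinearMap.ker (ordProj U) = nilPart U := by
  refine le_antisymm (fun x hx => ?_) fun x hx => ordProj_apply_of_mem_nilPart U hx
  rw [LinearMap.mem_ker] at hx
  have := sub_ordProj_mem_nilPart U x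
  rwa [hx, sub_zero] at this

/-- **`e` commutes with every endomorphism commuting with `U`** (in particular with `U` and with the
other Hecke operators). [folklore] -/
theorem ordProj_comm (U : Module.End R M) {g : Module.End R M} (hg : g.comp U = U.comp g) :
    (ordProj U).comp g = g.comp (ordProj U) := by
  refine LinearMap.ext fun x => ?_
  obtain ⟨n, hn, o, ho, rfl⟩ := exists_nil_add_ord U x
  simp only [LinearMap.comp_apply, map_add]
  rw [ordProj_apply_of_mem_nilPart U hn, ordProj_apply_of_mem_ordPart U ho,
    ordProj_apply_of_mem_nilPart U (nilPart_le_comap hg hn), ordProj_apply_of_mem_ordPart U (ordPart_le_comap hg ho),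
    map_zero, zero_add]

/-- `e` commutes with `U`. [folklore] -/
theorem ordProj_comm_self (U : Module.End R M) : (ordProj U).comp U = U.comp (ordProj U) :=
  ordProj_comm U rfl

/-! ### Naturality for `U`-equivariant maps -/

variable [IsNoetherian R M'] [IsArtinian R M']

omit [IsNoetherian R M] [IsArtinian R M] [IsNoetherian R M'] [IsArtinian R M'] in
/-- A `U`-equivariant linear map sends `M^{ord}` into `M'^{ord}`. [folklore] -/
theorem map_ordPart_le {U : Module.End R M} {U' : Module.End R M'} {S : M →ₗ[R] M'}
    (hS : S.comp U = U'.comp S) : (ordPart U).map S ≤ ordPart U' := by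
  rintro _ ⟨x, hx, rfl⟩
  rw [mem_ordPart_iff]
  intro n
  obtain ⟨y, rfl⟩ := mem_ordPart_iff.mp hx n
  exact ⟨S y, LinearMap.congr_fun (pow_comp_eq_comp_pow hS n) y⟩

omit [IsNoetherian R M] [IsArtinian R M] [IsNoetherian R M'] [IsArtinian R M'] in
/-- A `U`-equivariant linear map sends `M^{nil}` into `M'^{nil}`. [folklore] -/
theorem map_nilPart_le {U : Module.End R M} {U' : Module.End R M'} {S : M →ₗ[R] M'}
    (hS : S.comp U = U'.comp S) : (nilPart U).map S ≤ nilPart U' := by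
  rintro _ ⟨x, hx, rfl⟩
  revert hx
  refine fun hx => ?_
  induction hx using Submodule.iSup_induction' with
  | mem n x hx =>
    refine ker_pow_le_nilPart U' n ?_
    rw [LinearMap.mem_ker] at hx ⊢
    have := LinearMap.congr_fun (pow_comp_eq_comp_pow hS n) x
    rw [LinearMap.comp_apply, LinearMap.comp_apply] at this
    rw [this, hx, map_zero]
  | zero => rw [map_zero]; exact zero_mem _
  | add x y _ _ hx hy => rw [map_add]; exact add_mem hx hy

/-- **Naturality of the ordinary projector**: `S ∘ e = e' ∘ S` for `U`-equivariant `S`. [folklore] -/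
theorem map_ordProj {U : Module.End R M} {U' : Module.End R M'} {S : M →ₗ[R] M'}
    (hS : S.comp U = U'.comp S) : S.comp (ordProj U) = (ordProj U').comp S := by
  refine LinearMap.ext fun x => ?_
  obtain ⟨n, hn, o, ho, rfl⟩ := exists_nil_add_ord U x
  simp only [LinearMap.comp_apply, map_add]
  rw [ordProj_apply_of_mem_nilPart U hn, ordProj_apply_of_mem_ordPart U ho, map_zero, zero_add,
    ordProj_apply_of_mem_nilPart U' (map_nilPart_le hS ⟨n, hn, rfl⟩),
    ordProj_apply_of_mem_ordPart U' (map_ordPart_le hS ⟨o, ho, rfl⟩), zero_add]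

end HidaProjector

end Literature.NumberTheory.EllipticCurves
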